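import Summits.QuantumFields.QCD.Theorems.SpectralDefectExtinctionWindowExtinctionChessboardDefs
import Summits.QuantumFields.QCD.Theorems.SpectralDefectExtinctionWindowExtinctionChessboardGeometryBlocks
import Summits.QuantumFields.QCD.Theorems.SpectralDefectExtinctionWindowExtinctionChessboardGeometryKato

/-!
# Stub `stub_geometry` (S4, the flat-cube dichotomy) of line `chessboard-cold-cells`
(crux `Summit.QuantumFields.QCD.Theses.SpectralDefectExtinction.WindowExtinction`, item stmt-QuantumFields-8964)

**Flat-cube dichotomy.**  On the four-torus `(ℤ/L)⁴`, for every `SU(3)` link field `U`, every colour–spinor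
field `ψ ≠ 0` with covariant Wilson energy `dirichletForm U ψ ≤ λ‖ψ‖²` (`λ > 0`) and every block side `n ≥ 1`
with `64 n² λ ≤ 1`, `n + 1 ≤ L`, some block `t + {0,…,n}⁴` meeting the support of `ψ` contains at least
`n⁴/128` lowest corners of `λ`-flat spatial unit 3-cubes (`CubeFlat U · λ`).

Proof.
1. *Averaging* (`sum_cubeEnergy_le`, `flat_mass_ge`): restricting each spin component of `ψ` to the eight
   corners of the spatial unit cube with lowest corner `y` gives colour fields whose cube energies sum over
   `y` to `≤ 4·dirichletForm ≤ 4λ‖ψ‖²` (each spatial link lies in four spatial unit cubes; temporal terms are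
   dropped), while the cube masses `W(y)` sum to `8‖ψ‖²`; a non-flat cube has energy `> λ·mass`, so the flat
   cubes carry cube-mass `Σ_{flat} W ≥ 4‖ψ‖² = ½ Σ W`.
2. *Kato* (`cube_amplitude_energy_le`): the cube amplitude `b = √W` has free Dirichlet energy
   `Σ_{y,μ} (b(y+μ̂) − b(y))² ≤ 16·dirichletForm ≤ 2λ·ΣW` (sitewise Kato inequality of the tree, summed, and the
   reverse triangle inequality in `ℓ²` over the eight corners).
3. *Dense block* (`exists_block_of_energy`, Markov + the pairwise box Poincaré inequality summed over all
   translates, with `16·4·n²λ ≤ 1`): some box `t + {0,…,n−1}⁴` of positive `W`-mass contains `≥ n⁴/16`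
   lowest corners of flat cubes; it sits inside the block `t + {0,…,n}⁴`, which therefore contains
   `≥ n⁴/16 ≥ n⁴/128` of them and a corner `t + s + s'` (`s' ∈ {0,1}³` spatial) where `ψ ≠ 0`.
-/

noncomputable section

namespace Summit.QuantumFields.QCD.Cruxes.WindowExtinction.ChessboardColdCells

open scoped BigOperators Matrix Classical
open Literature.MathematicalPhysics Literature.MathematicalPhysics.QuantumLattice
  Literature.MathematicalPhysics.QuantumFieldTheory Literature.Probability.LatticeModels

variable {L : ℕ}

/-! ### Geometry of the spatial unit cube -/

/-- The time component of a spatial offset vanishes. -/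
theorem spatialOffset_apply_zero (s : Fin 3 → Fin 2) : (spatialOffset s : TorusSite 4 L) 0 = 0 := by
  simp [spatialOffset]

/-- The spatial components of a spatial offset. -/
theorem spatialOffset_apply_succ (s : Fin 3 → Fin 2) (i : Fin 3) :
    (spatialOffset s : TorusSite 4 L) i.succ = ((s i : ℕ) : ZMod L) := by
  simp [spatialOffset]

/-- Raising the `i`-th offset bit from `0` to `1` is a unit step in direction `i.succ`. -/
theorem spatialOffset_update (s : Fin 3 → Fin 2) (i : Fin 3) (hs : s i = 0) :
    (spatialOffset (Function.update s i 1) : TorusSite 4 L) = spatialOffset s + Pi.single i.succ 1 := by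
  funext μ
  refine Fin.cases ?_ (fun j => ?_) μ
  · rw [Pi.add_apply, spatialOffset_apply_zero, spatialOffset_apply_zero,
      Pi.single_eq_of_ne (Fin.succ_ne_zero i).symm, add_zero]
  · rw [Pi.add_apply, spatialOffset_apply_succ, spatialOffset_apply_succ]
    by_cases hj : j = i
    · subst hj
      rw [Function.update_self, Pi.single_eq_same, hs]
      simp
    · rw [Function.update_of_ne hj, Pi.single_eq_of_ne ((Fin.succ_injective _).ne hj), add_zero]

/-- The corner across the edge `i` from the corner `s` (with `s i = 0`) is its neighbour in direction
`i.succ`. -/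
theorem corner_update (y : TorusSite 4 L) (s : Fin 3 → Fin 2) (i : Fin 3) (hs : s i = 0) :
    corner y (Function.update s i 1) = QuantumFieldTheory.Site.shift (corner y s) i.succ := by
  rw [corner, corner, spatialOffset_update s i hs, QuantumFieldTheory.Site.shift, add_assoc]

/-- Corners of the translated cube are the translated corners. -/
theorem corner_shift (y : TorusSite 4 L) (s : Fin 3 → Fin 2) (μ : Fin 4) :
    corner (QuantumFieldTheory.Site.shift y μ) s = QuantumFieldTheory.Site.shift (corner y s) μ := by
  simp only [corner, QuantumFieldTheory.Site.shift, add_right_comm]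

variable [NeZero L]

/-! ### Step 1: averaging over spatial unit cubes -/

/-- The total cube mass is eight times the mass: `Σ_y Σ_{s,a,α} |ψ(y+s,a,α)|² = 8‖ψ‖²`. -/
theorem sum_cubeMass_eq (ψ : QuarkIdx L → ℂ) :
    ∑ y : TorusSite 4 L, ∑ s : Fin 3 → Fin 2, ∑ a : Fin 3, ∑ α : Fin 4, ‖ψ (corner y s, a, α)‖ ^ 2 =
      8 * ∑ i, ‖ψ i‖ ^ 2 := by
  calc _ = ∑ s : Fin 3 → Fin 2, ∑ y : TorusSite 4 L, ∑ a : Fin 3, ∑ α : Fin 4,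
        ‖ψ (corner y s, a, α)‖ ^ 2 := Finset.sum_comm
    _ = ∑ _s : Fin 3 → Fin 2, ∑ x : TorusSite 4 L, ∑ a : Fin 3, ∑ α : Fin 4, ‖ψ (x, a, α)‖ ^ 2 :=
        Finset.sum_congr rfl fun s _ => Equiv.sum_comp (Equiv.addRight (spatialOffset s : TorusSite 4 L))
          (fun x => ∑ a : Fin 3, ∑ α : Fin 4, ‖ψ (x, a, α)‖ ^ 2)
    _ = 8 * ∑ i, ‖ψ i‖ ^ 2 := by
        rw [Finset.sum_const, Finset.card_univ, nsmul_eq_mul]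
        simp only [Fintype.sum_prod_type, Fintype.card_fun, Fintype.card_fin]
        norm_num

/-- **Each spatial link lies in four spatial unit cubes.**  Summed over all lowest corners `y` and spin
components `α`, the cube energies of the restrictions of `ψ` are at most twice the full (un-halved) Wilson
energy sum, i.e. `Σ_y Σ_α cubeEnergy ≤ 4·dirichletForm U ψ` (temporal links dropped). -/
theorem sum_cubeEnergy_le (U : GaugeConfig 4 L SU3) (ψ : QuarkIdx L → ℂ) :
    ∑ y : TorusSite 4 L, ∑ α : Fin 4, cubeEnergy U y (fun s a => ψ (corner y s, a, α)) ≤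
      2 * ∑ x : TorusSite 4 L, ∑ μ : Fin 4, ∑ a : Fin 3, ∑ α : Fin 4,
        ‖ψ (x, a, α) - ∑ b : Fin 3, (fundamentalRep (Fin 3) (U (x, μ))) a b *
          ψ (QuantumFieldTheory.Site.shift x μ, b, α)‖ ^ 2 := by
  set e : TorusSite 4 L → Fin 4 → ℝ := fun x μ => ∑ a : Fin 3, ∑ α : Fin 4,
    ‖ψ (x, a, α) - ∑ b : Fin 3, (fundamentalRep (Fin 3) (U (x, μ))) a b *
      ψ (QuantumFieldTheory.Site.shift x μ, b, α)‖ ^ 2 with he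
  change _ ≤ 2 * ∑ x, ∑ μ, e x μ
  have henn : ∀ x μ, 0 ≤ e x μ := fun x μ => by positivity
  -- the cube energies of the spin components, edge by edge
  have hcube : ∀ y : TorusSite 4 L, ∑ α : Fin 4, cubeEnergy U y (fun s a => ψ (corner y s, a, α)) =
      (1 / 2 : ℝ) * ∑ s : Fin 3 → Fin 2, ∑ i : Fin 3, if s i = 0 then e (corner y s) i.succ else 0 := by
    intro y
    simp only [cubeEnergy, ← Finset.mul_sum]
    congr 1
    rw [Finset.sum_comm]
    refine Finset.sum_congr rfl fun s _ => ?_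
    rw [Finset.sum_comm]
    refine Finset.sum_congr rfl fun i _ => ?_
    by_cases h : s i = 0
    · simp only [if_pos h, he]
      rw [Finset.sum_comm, corner_update y s i h]
      rfl
    · simp only [if_neg h, Finset.sum_const_zero]
  -- four offsets `s ∈ {0,1}³` have `s i = 0`
  have h4 : ∀ i : Fin 3, ((Finset.univ.filter fun s : Fin 3 → Fin 2 => s i = 0).card : ℝ) = 4 := by
    intro i
    have : (Finset.univ.filter fun s : Fin 3 → Fin 2 => s i = 0).card = 4 := by
      fin_cases i <;> decide
    rw [this]
    norm_num
  calc ∑ y, ∑ α, cubeEnergy U y (fun s a => ψ (corner y s, a, α))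
      = ∑ y, (1 / 2 : ℝ) * ∑ s : Fin 3 → Fin 2, ∑ i : Fin 3,
          if s i = 0 then e (corner y s) i.succ else 0 := Finset.sum_congr rfl fun y _ => hcube y
    _ = (1 / 2 : ℝ) * ∑ s : Fin 3 → Fin 2, ∑ i : Fin 3, ∑ y : TorusSite 4 L,
          if s i = 0 then e (corner y s) i.succ else 0 := by
        rw [← Finset.mul_sum]
        congr 1
        rw [Finset.sum_comm]
        exact Finset.sum_congr rfl fun s _ => Finset.sum_comm
    _ = (1 / 2 : ℝ) * ∑ s : Fin 3 → Fin 2, ∑ i : Fin 3, if s i = 0 then ∑ x, e x i.succ else 0 := by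
        congr 1
        refine Finset.sum_congr rfl fun s _ => Finset.sum_congr rfl fun i _ => ?_
        split_ifs with h
        · exact Equiv.sum_comp (Equiv.addRight (spatialOffset s : TorusSite 4 L)) (fun x => e x i.succ)
        · simp
    _ = (1 / 2 : ℝ) * ∑ i : Fin 3, 4 * ∑ x, e x i.succ := by
        congr 1
        rw [Finset.sum_comm]
        refine Finset.sum_congr rfl fun i _ => ?_
        rw [← Finset.sum_filter, Finset.sum_const, nsmul_eq_mul, h4]
    _ = 2 * ∑ x, ∑ i : Fin 3, e x i.succ := by
        rw [← Finset.mul_sum, Finset.sum_comm]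
        ring
    _ ≤ 2 * ∑ x, ∑ μ : Fin 4, e x μ := by
        gcongr with x _
        linarith [Fin.sum_univ_succ (fun μ : Fin 4 => e x μ), henn x 0]

/-- **Flat cubes carry half of the cube mass.**  If `dirichletForm U ψ ≤ λ‖ψ‖²` with `λ > 0`, then
`Σ_y W(y) ≤ 2 Σ_{y : CubeFlat U y λ} W(y)` for the cube mass `W(y) = Σ_{s,a,α} |ψ(y+s,a,α)|²`
(a non-flat cube has cube energy `≥ λ W(y)`; sum and compare with `sum_cubeEnergy_le`). -/
theorem flat_mass_ge (U : GaugeConfig 4 L SU3) (ψ : QuarkIdx L → ℂ) (lam : ℝ) (hlam : 0 < lam)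
    (hE : dirichletForm U ψ ≤ lam * ∑ i, ‖ψ i‖ ^ 2) :
    ∑ y : TorusSite 4 L, ∑ s : Fin 3 → Fin 2, ∑ a : Fin 3, ∑ α : Fin 4, ‖ψ (corner y s, a, α)‖ ^ 2 ≤
      2 * ∑ y ∈ Finset.univ.filter (fun y : TorusSite 4 L => CubeFlat U y lam),
        ∑ s : Fin 3 → Fin 2, ∑ a : Fin 3, ∑ α : Fin 4, ‖ψ (corner y s, a, α)‖ ^ 2 := by
  set Wc : TorusSite 4 L → ℝ := fun y =>
    ∑ s : Fin 3 → Fin 2, ∑ a : Fin 3, ∑ α : Fin 4, ‖ψ (corner y s, a, α)‖ ^ 2 with hWc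
  have htot : ∑ y, Wc y = 8 * ∑ i, ‖ψ i‖ ^ 2 := sum_cubeMass_eq ψ
  change ∑ y, Wc y ≤ 2 * ∑ y ∈ Finset.univ.filter (fun y : TorusSite 4 L => CubeFlat U y lam), Wc y
  -- a non-flat cube has energy `≥ λ · mass` on every colour field, in particular on the spin components
  have hnf : ∀ y : TorusSite 4 L, ¬ CubeFlat U y lam →
      lam * Wc y ≤ ∑ α : Fin 4, cubeEnergy U y (fun s a => ψ (corner y s, a, α)) := by
    intro y hy
    have key : ∀ v : (Fin 3 → Fin 2) → Fin 3 → ℂ, lam * cubeMass v ≤ cubeEnergy U y v := by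
      intro v
      by_cases hv : v = 0
      · subst hv
        simp [cubeMass, cubeEnergy]
      · by_contra h
        exact hy ⟨v, hv, (not_le.mp h).le⟩
    calc lam * Wc y = ∑ α : Fin 4, lam * cubeMass (fun s a => ψ (corner y s, a, α)) := by
          simp only [hWc, cubeMass]
          rw [← Finset.mul_sum]
          congr 1
          exact sum_sum_sum_comm _
      _ ≤ _ := Finset.sum_le_sum fun α _ => key _
  -- hence the non-flat cubes carry cube-mass `≤ 4‖ψ‖²`
  have hbad : lam * ∑ y ∈ Finset.univ.filter (fun y : TorusSite 4 L => ¬ CubeFlat U y lam), Wc y ≤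
      lam * (4 * ∑ i, ‖ψ i‖ ^ 2) := by
    calc lam * ∑ y ∈ Finset.univ.filter (fun y : TorusSite 4 L => ¬ CubeFlat U y lam), Wc y
        = ∑ y ∈ Finset.univ.filter (fun y : TorusSite 4 L => ¬ CubeFlat U y lam), lam * Wc y :=
          Finset.mul_sum _ _ _
      _ ≤ ∑ y ∈ Finset.univ.filter (fun y : TorusSite 4 L => ¬ CubeFlat U y lam),
            ∑ α : Fin 4, cubeEnergy U y (fun s a => ψ (corner y s, a, α)) :=
          Finset.sum_le_sum fun y hy => hnf y (Finset.mem_filter.mp hy).2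
      _ ≤ ∑ y, ∑ α : Fin 4, cubeEnergy U y (fun s a => ψ (corner y s, a, α)) :=
          Finset.sum_le_univ_sum_of_nonneg fun y => Finset.sum_nonneg fun α _ => cubeEnergy_nonneg U y _
      _ ≤ _ := sum_cubeEnergy_le U ψ
      _ = 4 * dirichletForm U ψ := by
          simp only [dirichletForm]
          ring
      _ ≤ 4 * (lam * ∑ i, ‖ψ i‖ ^ 2) := by linarith [hE]
      _ = lam * (4 * ∑ i, ‖ψ i‖ ^ 2) := by ring
  have hbad' := le_of_mul_le_mul_left hbad hlam
  have hsplit := Finset.sum_filter_add_sum_filter_not Finset.univ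
    (fun y : TorusSite 4 L => CubeFlat U y lam) Wc
  linarith [hsplit, htot, hbad']

/-! ### Step 2: Kato's inequality for the cube amplitude -/

/-- **Free Dirichlet energy of the cube amplitude.**  With the cube mass `W(y) = Σ_{s,a,α} |ψ(y+s,a,α)|²`,
the amplitude `√W` satisfies `Σ_{y,μ} (√W(y+μ̂) − √W(y))² ≤ 16·dirichletForm U ψ`
(reverse triangle inequality over the eight corners + the sitewise Kato inequality, each site counted
eight times). -/
theorem cube_amplitude_energy_le (U : GaugeConfig 4 L SU3) (ψ : QuarkIdx L → ℂ) :
    ∑ y : TorusSite 4 L, ∑ μ : Fin 4,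
      (Real.sqrt (∑ s : Fin 3 → Fin 2, ∑ a : Fin 3, ∑ α : Fin 4,
          ‖ψ (corner (QuantumFieldTheory.Site.shift y μ) s, a, α)‖ ^ 2) -
        Real.sqrt (∑ s : Fin 3 → Fin 2, ∑ a : Fin 3, ∑ α : Fin 4, ‖ψ (corner y s, a, α)‖ ^ 2)) ^ 2 ≤
      16 * dirichletForm U ψ := by
  have hk := kato_amplitude_energy_le L U ψ
  set F : TorusSite 4 L → Fin 4 → ℝ := fun x μ =>
    (Real.sqrt (∑ a : Fin 3, ∑ α : Fin 4, ‖ψ (QuantumFieldTheory.Site.shift x μ, a, α)‖ ^ 2) -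
      Real.sqrt (∑ a : Fin 3, ∑ α : Fin 4, ‖ψ (x, a, α)‖ ^ 2)) ^ 2 with hF
  have hk' : ∑ x : TorusSite 4 L, ∑ μ : Fin 4, F x μ ≤ 2 * dirichletForm U ψ := by
    simp only [dirichletForm]
    linarith [hk]
  -- sitewise: reverse triangle inequality over the eight corners
  have hpt : ∀ (y : TorusSite 4 L) (μ : Fin 4),
      (Real.sqrt (∑ s : Fin 3 → Fin 2, ∑ a : Fin 3, ∑ α : Fin 4,
          ‖ψ (corner (QuantumFieldTheory.Site.shift y μ) s, a, α)‖ ^ 2) -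
        Real.sqrt (∑ s : Fin 3 → Fin 2, ∑ a : Fin 3, ∑ α : Fin 4, ‖ψ (corner y s, a, α)‖ ^ 2)) ^ 2 ≤
      ∑ s : Fin 3 → Fin 2, F (corner y s) μ := by
    intro y μ
    refine (sqrt_sum_sub_sqrt_sum_sq_le _ _ _ (fun s _ => by positivity) (fun s _ => by positivity)).trans_eq
      (Finset.sum_congr rfl fun s _ => ?_)
    rw [corner_shift]
  calc _ ≤ ∑ y : TorusSite 4 L, ∑ μ : Fin 4, ∑ s : Fin 3 → Fin 2, F (corner y s) μ :=
        Finset.sum_le_sum fun y _ => Finset.sum_le_sum fun μ _ => hpt y μ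
    _ = ∑ s : Fin 3 → Fin 2, ∑ y : TorusSite 4 L, ∑ μ : Fin 4, F (corner y s) μ := sum_sum_sum_comm _
    _ = ∑ _s : Fin 3 → Fin 2, ∑ x : TorusSite 4 L, ∑ μ : Fin 4, F x μ :=
        Finset.sum_congr rfl fun s _ => Equiv.sum_comp (Equiv.addRight (spatialOffset s : TorusSite 4 L))
          (fun x => ∑ μ : Fin 4, F x μ)
    _ = 8 * ∑ x : TorusSite 4 L, ∑ μ : Fin 4, F x μ := by
        rw [Finset.sum_const, Finset.card_univ, nsmul_eq_mul]
        simp only [Fintype.card_fun, Fintype.card_fin]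
        norm_num
    _ ≤ 8 * (2 * dirichletForm U ψ) := by linarith [hk']
    _ = 16 * dirichletForm U ψ := by ring

/-! ### Step 3: the flat-cube dichotomy -/

/-- **(S4) Flat-cube dichotomy** (registered stub `stub_geometry` of line `chessboard-cold-cells`).
On any torus of side `L`, for every gauge field `U`, every colour–spinor field `ψ ≠ 0` with covariant
Wilson energy `dirichletForm U ψ ≤ λ‖ψ‖²` (`λ > 0`) and every block side `n ≥ 1` with `64 n² λ ≤ 1` and
`n + 1 ≤ L`, some block `t + {0,…,n}⁴` meeting the support of `ψ` contains at least `n⁴/128` lowest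
corners of `λ`-flat spatial unit 3-cubes. -/
theorem stub_geometry : ∀ (L : ℕ) [NeZero L] (U : GaugeConfig 4 L SU3) (ψ : QuarkIdx L → ℂ) (lam : ℝ) (n : ℕ),
    ψ ≠ 0 → 0 < lam → 1 ≤ n → n + 1 ≤ L → 64 * (n : ℝ) ^ 2 * lam ≤ 1 →
    dirichletForm U ψ ≤ lam * ∑ i, ‖ψ i‖ ^ 2 →
      ∃ t : TorusSite 4 L,
        (n : ℝ) ^ 4 / 128 ≤
          ((Finset.univ.filter fun s : Fin 4 → Fin (n + 1) =>
              CubeFlat U (t + fun μ => ((s μ : ℕ) : ZMod L)) lam).card : ℝ) ∧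
        ∃ (s : Fin 4 → Fin (n + 1)) (a : Fin 3) (α : Fin 4),
          ψ (t + (fun μ => ((s μ : ℕ) : ZMod L)), a, α) ≠ 0 := by
  intro L _ U ψ lam n hψ hlam hn _hnL hsmall hE
  -- the cube mass, its total, positivity
  have hWnn : ∀ y : TorusSite 4 L,
      0 ≤ ∑ s : Fin 3 → Fin 2, ∑ a : Fin 3, ∑ α : Fin 4, ‖ψ (corner y s, a, α)‖ ^ 2 := fun y => by
    positivity
  have htot := sum_cubeMass_eq ψ
  have hMpos : 0 < ∑ i, ‖ψ i‖ ^ 2 := by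
    obtain ⟨i, hi⟩ := Function.ne_iff.mp hψ
    exact lt_of_lt_of_le (by positivity : 0 < ‖ψ i‖ ^ 2)
      (Finset.single_le_sum (fun j _ => sq_nonneg ‖ψ j‖) (Finset.mem_univ i))
  -- dense-block selection with side `n`
  obtain ⟨t, hcount, hmass⟩ := exists_block_of_energy (d := 4) n hn
    (fun y : TorusSite 4 L => ∑ s : Fin 3 → Fin 2, ∑ a : Fin 3, ∑ α : Fin 4, ‖ψ (corner y s, a, α)‖ ^ 2)
    (fun y : TorusSite 4 L =>
      Real.sqrt (∑ s : Fin 3 → Fin 2, ∑ a : Fin 3, ∑ α : Fin 4, ‖ψ (corner y s, a, α)‖ ^ 2))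
    (fun y : TorusSite 4 L => CubeFlat U y lam) lam
    (fun y => (Real.sq_sqrt (hWnn y)).symm)
    (by rw [htot]; positivity)
    (flat_mass_ge U ψ lam hlam hE)
    (by
      calc _ ≤ 16 * dirichletForm U ψ := cube_amplitude_energy_le U ψ
        _ ≤ 16 * (lam * ∑ i, ‖ψ i‖ ^ 2) := by linarith [hE]
        _ = _ := by rw [htot]; ring)
    (by norm_num; linarith [hsmall])
  refine ⟨t, ?_, ?_⟩
  · -- at least `n⁴/16 ≥ n⁴/128` flat cubes with lowest corner in `t + {0,…,n−1}⁴ ⊆ t + {0,…,n}⁴`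
    have hmono : (Finset.univ.filter fun s : Fin 4 → Fin n =>
          CubeFlat U (t + fun μ => ((s μ : ℕ) : ZMod L)) lam).card ≤
        (Finset.univ.filter fun s : Fin 4 → Fin (n + 1) =>
          CubeFlat U (t + fun μ => ((s μ : ℕ) : ZMod L)) lam).card := by
      apply Finset.card_le_card_of_injOn (fun (s : Fin 4 → Fin n) (μ : Fin 4) => Fin.castSucc (s μ))
      · intro s hs
        rw [Finset.mem_coe, Finset.mem_filter] at hs ⊢
        refine ⟨Finset.mem_univ _, ?_⟩
        simpa only [Fin.val_castSucc] using hs.2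
      · intro s _ s' _ h
        funext μ
        exact Fin.castSucc_injective _ (congr_fun h μ)
    have hmono' : ((Finset.univ.filter fun s : Fin 4 → Fin n =>
          CubeFlat U (t + fun μ => ((s μ : ℕ) : ZMod L)) lam).card : ℝ) ≤
        ((Finset.univ.filter fun s : Fin 4 → Fin (n + 1) =>
          CubeFlat U (t + fun μ => ((s μ : ℕ) : ZMod L)) lam).card : ℝ) := by
      exact_mod_cast hmono
    have h128 : (n : ℝ) ^ 4 / 128 ≤ (n : ℝ) ^ 4 / 16 :=
      div_le_div_of_nonneg_left (by positivity) (by norm_num) (by norm_num)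
    linarith [hcount, hmono', h128]
  · -- the block `t + {0,…,n−1}⁴` has positive cube mass: `ψ ≠ 0` at a corner `t + s + s'`
    obtain ⟨s, -, hs⟩ := Finset.exists_ne_zero_of_sum_ne_zero hmass.ne'
    obtain ⟨s', -, hs'⟩ := Finset.exists_ne_zero_of_sum_ne_zero hs
    obtain ⟨a, -, ha⟩ := Finset.exists_ne_zero_of_sum_ne_zero hs'
    obtain ⟨α, -, hα⟩ := Finset.exists_ne_zero_of_sum_ne_zero ha
    have hψne : ψ (corner (t + fun μ => ((s μ : ℕ) : ZMod L)) s', a, α) ≠ 0 := by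
      intro h0
      apply hα
      rw [h0, norm_zero]
      norm_num
    -- the corner `t + s + s'` as a point of the block `t + {0,…,n}⁴`
    have hoff : ∀ μ : Fin 4, (Fin.cons 0 (fun i : Fin 3 => (s' i : ℕ)) : Fin 4 → ℕ) μ ≤ 1 := by
      intro μ
      refine Fin.cases ?_ (fun i => ?_) μ
      · simp
      · simp only [Fin.cons_succ]
        have := (s' i).isLt
        omega
    obtain ⟨r, hr⟩ : ∃ r : Fin 4 → Fin (n + 1),
        ∀ μ, (r μ : ℕ) = (s μ : ℕ) + (Fin.cons 0 (fun i : Fin 3 => (s' i : ℕ)) : Fin 4 → ℕ) μ :=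
      ⟨fun μ => ⟨(s μ : ℕ) + (Fin.cons 0 (fun i : Fin 3 => (s' i : ℕ)) : Fin 4 → ℕ) μ, by
        have h1 := (s μ).isLt
        have h2 := hoff μ
        omega⟩, fun μ => rfl⟩
    have hpoint : (t + fun μ => ((r μ : ℕ) : ZMod L)) = corner (t + fun μ => ((s μ : ℕ) : ZMod L)) s' := by
      funext μ
      rw [corner, spatialOffset]
      simp only [Pi.add_apply, hr, Nat.cast_add, add_assoc]
      congr 2
      refine Fin.cases ?_ (fun i => ?_) μ
      · simp
      · simp
    exact ⟨r, a, α, by rw [hpoint]; exact hψne⟩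

end Summit.QuantumFields.QCD.Cruxes.WindowExtinction.ChessboardColdCells

end
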